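import Literature.AlgebraicGeometry.Resolution.PsiBirationalChart
import Literature.AlgebraicGeometry.Resolution.PointBlowupHsFunMono
import Literature.AlgebraicGeometry.Resolution.BlowupStalkCharts
import Literature.AlgebraicGeometry.Resolution.AffineBlowupAlgebra
import Literature.AlgebraicGeometry.Resolution.BennettDimOne
import HarnessLib

/-!
# `ψ_X(π x') ≤ ψ_{X'}(x')` and `H_{X'}(x') ≤ H_X(π x')` on a blow-up of an ARBITRARY locally
# noetherian scheme (CJS 2020, Thm. 3.10 (1), (3.7)–(3.9), (3.13), case `δ = 0`)

Topic: `Literature/AlgebraicGeometry/Resolution`. Cossart–Jannsen–Saito, LNM 2270, Thm. 3.10 (1)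
for a permissible blow-up `π : X' → X` and `x' ↦ x`: "`H^{(δ)}_{𝒪_{X',x'}} ≤ H^{(0)}_{𝒪_{X,x}}` and
`φ_{X'}(x') ≤ φ_X(x) + δ` and `H_{X'}(x') ≤ H_X(x)`", the middle inequality being
"(3.7) `ψ_X(x) ≤ ψ_{X'}(x') + δ`" (proof, p. 44, via the strict transforms of the irreducible
components of `X` and the dimension formula (3.8)).

The tree proves the third inequality for the blow-up of a closed point of an INTEGRAL `X`
(`PointBlowupHilbertSamuelStrata.lean`, `PointBlowupHsFunMono.lean`: there `ψ = dim`). The reduced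
excellent surfaces of CJS Thm. 1.2 (`CossartJannsenSaito2020General`) are in general REDUCIBLE and
not equidimensional, and then `ψ` genuinely moves. This file PROVES, for a blowing up `π : X' → X`
(`IsBlowup π J`) of an arbitrary locally noetherian scheme `X` along an arbitrary centre `J`, and a
point `x'` with `𝒪_{X,π x'}` universally catenary (e.g. `X` excellent) and `k(x')` algebraic over
`k(π x')` (every germ at `x'` is killed modulo `𝔪_{x'}` by a monic polynomial pulled back from
`π x'`; `δ = 0`):

* `IsBlowup.hsPsi_le_of_residuallyIntegral` — **(3.7) with `δ = 0`: `ψ_X(π x') ≤ ψ_{X'}(x')`**: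
  `𝒪_{X',x'}` is a localization of a chart `B_j = 𝒪_{X,x}[J_x/c_j] ↪ 𝒪_{X,x}[1/c_j]`
  (`IsBlowup.exists_reesChart_stalk`, Stacks 0804, 07Z3) at a prime over `𝔪_x`, so the ring
  statement `minimalPrimesCodim_le_of_isLocalization_chart` (`PsiBirationalChart.lean`) applies;
  `IsBlowup.hsPsi_le_ringKrullDim_of_residuallyIntegral` — and `ψ_{X'}(x') ≤ dim 𝒪_{X,π x'}`
  ((3.8): the minimum is `dim 𝒪_{X,π x'}/Q` for some minimal prime `Q`);
* `IsBlowup.hsPsi_eq_of_residuallyIntegral_of_injective` — **(3.13) with `δ = 0`: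
  `ψ_{X'}(x') = ψ_X(π x')` if `π^♯_{x'} : 𝒪_{X,π x'} → 𝒪_{X',x'}` is injective** (Thm. 3.10 (3),
  Lemma 3.11);
* `IsBlowup.hsFun_le_of_residuallyFinite_of_isUniversallyCatenaryRing`,
  `IsBlowup.hsFun_le_of_finite_residueFieldMap_of_isUniversallyCatenaryRing` —
  **`H^N_{X'}(x') ≤ H^N_X(π x')` for the blow-up of a closed point (`J_x = 𝔪_x`) of an ARBITRARY
  locally noetherian `X` at the residually finite points `x'` of the fibre**, for `N > ψ_{X'}(x')`,
  resp. `N > dim 𝒪_{X,x}`: the Bennett–Hironaka inequality `H^{(1)}(𝒪_{X',x'}) ≤ H^{(1)}(𝒪_{X,x})`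
  (`IsBlowup.hilbertSamuelFun_stalk_le_of_residuallyFinite`, which needs no integrality) shifted by
  `φ = N − ψ` using (3.7) (`hilbertSamuelFun_sub_le_of_le`, the arithmetic of (3.9));
* `IsBlowup.hsFun_le_of_point_centre'`, `IsBlowup.hsFun_le_of_point_centre_of_isQuasiExcellent`,
  `IsBlowup.hsFun_le_of_point_centre_of_locallyOfFiniteType` — **`H^N_{X'}(x') ≤ H^N_X(π x')` at
  EVERY point of the blow-up of a closed point `x`** with `𝒪_{X,x}` universally catenary, of a
  quasi-excellent `X`, resp. of any scheme locally of finite type over a field, for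
  `N > dim 𝒪_{X,x}`: the assembly of `PointBlowupHsFunMono.lean` (off the fibre an equality; a
  non-closed point of the fibre specialises without decrease of `H_{X'}` to a closed point of the
  fibre, CJS Thm. 2.33 (1) along a regular closure) with the integrality hypothesis removed. This
  is the hypothesis `hmono` of `Scheme.no_infinite_hsFun_tower` for such blow-ups of reducible
  schemes.

No definitions and no named facts are introduced.

## Sources

* V. Cossart, U. Jannsen, S. Saito, *Desingularization: Invariants and Strategy*, LNM 2270
  (2020), Thm. 3.10 (1), (3) and proof, (3.7)–(3.9), (3.13) (p. 43–45); Thm. 2.33 (1).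
  [CossartJannsenSaito2020]
* The Stacks Project, Tags 0804, 07Z3, 02OS, 01TB. [StacksProject]
-/

noncomputable section

open CategoryTheory AlgebraicGeometry IsLocalRing Polynomial
open Literature.RingTheory.HilbertSamuel Literature.AlgebraicGeometry.Resolution

/-! ## A ring-level complement: `ψ(𝒪') ≤ dim 𝒪` -/

namespace Literature.RingTheory.HilbertSamuel

universe u

/-- In the situation of `minimalPrimesCodim_le_of_isLocalization_chart` also
**`ψ(𝒪') ≤ dim 𝒪`**: `ψ(𝒪') = dim 𝒪'/Q'' = dim 𝒪/(Q'' ∩ 𝒪) ≤ dim 𝒪` for a suitable minimal prime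
`Q''` of `𝒪'`. [cite: CossartJannsenSaito2020, Thm. 3.10 (1) (proof, (3.8))] -/
theorem minimalPrimesCodim_le_ringKrullDim_of_isLocalization_chart {O : Type u} [CommRing O]
    [IsLocalRing O] (M : Submonoid O) (S : Type u) [CommRing S] [Algebra O S] [IsLocalization M S]
    (C : Type u) [CommRing C] [Algebra O C] [Algebra C S] [IsScalarTower O C S] (P : Ideal C)
    [P.IsPrime] [P.LiesOver (maximalIdeal O)] (O' : Type u) [CommRing O'] [Algebra C O']
    [IsLocalization.AtPrime O' P] [IsLocalRing O'] (hO : IsUniversallyCatenaryRing O)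
    [Algebra.FiniteType O C] (hinj : Function.Injective (algebraMap C S))
    (hres : ∀ c : C, ∃ f : O[X], f.Monic ∧ f.eval₂ (algebraMap O C) c ∈ P)
    [Algebra O O'] [IsScalarTower O C O'] :
    (minimalPrimesCodim O' : WithBot ℕ∞) ≤ ringKrullDim O := by
  haveI : IsNoetherianRing O := hO.1
  haveI : IsNoetherianRing C := Algebra.FiniteType.isNoetherianRing O C
  haveI : IsNoetherianRing O' := IsLocalization.isNoetherianRing P.primeCompl O' inferInstance
  obtain ⟨Q'', hQ'', hdim⟩ := exists_minimalPrimes_ringKrullDim_eq_minimalPrimesCodim O'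
  obtain ⟨-, hdim'⟩ :=
    ringKrullDim_quotient_eq_of_mem_minimalPrimes_localization M S C P O' hO hinj hres hQ''
  rw [← hdim, hdim']
  exact ringKrullDim_quotient_le _

end Literature.RingTheory.HilbertSamuel

namespace Literature.AlgebraicGeometry.Resolution

universe u

variable {X X' : Scheme.{u}} {π : X' ⟶ X} {J : X.IdealSheafData}

/-! ## `ψ` along a blow-up at residually algebraic points -/

/-- **The three facts about `ψ` at a residually algebraic point of a blow-up of an arbitrary
locally noetherian scheme** (`𝒪_{X,π x'}` universally catenary): (3.7) `ψ_X(π x') ≤ ψ_{X'}(x')`;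
`ψ_{X'}(x') ≤ dim 𝒪_{X,π x'}`; and (3.13) `ψ_{X'}(x') = ψ_X(π x')` if `𝒪_{X,π x'} → 𝒪_{X',x'}` is
injective — read off from the chart presentation `𝒪_{X',x'} = (B_j)_𝔴`, `B_j ↪ 𝒪_{X,x}[1/c_j]`
(`IsBlowup.exists_reesChart_stalk`) by `PsiBirationalChart.lean`.
[cite: CossartJannsenSaito2020, Thm. 3.10 (1), (3) (proof, (3.7), (3.8), (3.13))] -/
theorem IsBlowup.hsPsi_le_and_le_and_eq_of_residuallyIntegral [IsLocallyNoetherian X]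
    (hπ : IsBlowup π J) (x' : X') (hUC : IsUniversallyCatenaryRing (X.presheaf.stalk (π.base x')))
    (hint : ∀ y : X'.presheaf.stalk x', ∃ P : (X.presheaf.stalk (π.base x'))[X], P.Monic ∧
      (P.map (π.stalkMap x').hom).eval y ∈ maximalIdeal (X'.presheaf.stalk x')) :
    Scheme.hsPsi X (π.base x') ≤ Scheme.hsPsi X' x' ∧
      (Scheme.hsPsi X' x' : WithBot ℕ∞) ≤ ringKrullDim (X.presheaf.stalk (π.base x')) ∧
      (Function.Injective (π.stalkMap x').hom → Scheme.hsPsi X' x' = Scheme.hsPsi X (π.base x')) := by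
  classical
  obtain ⟨k, c, hc⟩ := Submodule.fg_iff_exists_fin_generating_family.mp
    (IsNoetherian.noetherian (stalkIdeal J (π.base x')))
  obtain ⟨j, 𝔴, χ, hχ, hloc, h𝔴⟩ := hπ.exists_reesChart_stalk x' c hc
  -- the chart `C = B_j`, its structure map, its embedding into `S = 𝒪_{X,x}[1/c_j]`
  letI algRC : Algebra (X.presheaf.stalk (π.base x')) (chartRing c j) := (chartBase c j).toAlgebra
  letI algCO : Algebra (chartRing c j) (X'.presheaf.stalk x') := χ.toAlgebra
  letI algRO : Algebra (X.presheaf.stalk (π.base x')) (X'.presheaf.stalk x') :=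
    (π.stalkMap x').hom.toAlgebra
  haveI hT1 := IsScalarTower.of_algebraMap_eq (R := X.presheaf.stalk (π.base x'))
    (S := chartRing c j) (A := X'.presheaf.stalk x') fun r => (hχ r).symm
  have hcj : c j ∈ Ideal.span (Set.range c) := Ideal.mem_span_range_self (f := c) (x := j)
  letI algCS : Algebra (chartRing c j) (Localization.Away (c j)) := (reesChart (c j) hcj).toAlgebra
  haveI hT2 := IsScalarTower.of_algebraMap_eq (R := X.presheaf.stalk (π.base x'))
    (S := chartRing c j) (A := Localization.Away (c j))
    fun r => (reesChart_reesChartBase (c j) hcj r).symm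
  haveI : Algebra.FiniteType (X.presheaf.stalk (π.base x')) (chartRing c j) := finiteType_chart c j
  haveI : IsLocalization.AtPrime (X'.presheaf.stalk x') 𝔴.asIdeal := hloc
  haveI : 𝔴.asIdeal.LiesOver (maximalIdeal (X.presheaf.stalk (π.base x'))) := ⟨h𝔴.symm⟩
  have hinj : Function.Injective (algebraMap (chartRing c j) (Localization.Away (c j))) :=
    reesChart_injective (c j) hcj
  -- residual integrality of `C/𝔴`
  have hmem : ∀ b : chartRing c j, χ b ∈ maximalIdeal (X'.presheaf.stalk x') ↔ b ∈ 𝔴.asIdeal :=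
    fun b => IsLocalization.AtPrime.to_map_mem_maximal_iff (X'.presheaf.stalk x') 𝔴.asIdeal b
  have hχc : (π.stalkMap x').hom = χ.comp (chartBase c j) := RingHom.ext fun r => (hχ r).symm
  have hres : ∀ b : chartRing c j, ∃ f : (X.presheaf.stalk (π.base x'))[X], f.Monic ∧
      f.eval₂ (algebraMap (X.presheaf.stalk (π.base x')) (chartRing c j)) b ∈ 𝔴.asIdeal := by
    intro b
    obtain ⟨P, hP, hPb⟩ := hint (χ b)
    refine ⟨P, hP, (hmem _).mp ?_⟩
    rw [hχc, ← Polynomial.map_map, Polynomial.eval_map, Polynomial.eval₂_at_apply] at hPb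
    rw [← Polynomial.eval_map]
    exact hPb
  exact ⟨minimalPrimesCodim_le_of_isLocalization_chart (Submonoid.powers (c j))
      (Localization.Away (c j)) (chartRing c j) 𝔴.asIdeal (X'.presheaf.stalk x') hUC hinj hres,
    minimalPrimesCodim_le_ringKrullDim_of_isLocalization_chart (Submonoid.powers (c j))
      (Localization.Away (c j)) (chartRing c j) 𝔴.asIdeal (X'.presheaf.stalk x') hUC hinj hres,
    fun hinjπ => minimalPrimesCodim_eq_of_isLocalization_chart_of_injective (Submonoid.powers (c j))
      (Localization.Away (c j)) (chartRing c j) 𝔴.asIdeal (X'.presheaf.stalk x') hUC hinj hres hinjπ⟩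

/-- **CJS (3.7) with `δ = 0` on a blow-up of an arbitrary locally noetherian scheme:
`ψ_X(π x') ≤ ψ_{X'}(x')`** at every point `x'` with `𝒪_{X,π x'}` universally catenary and `k(x')`
algebraic over `k(π x')` (residual integrality: every germ at `x'` is killed modulo `𝔪_{x'}` by a
monic polynomial with coefficients pulled back from `π x'`).
[cite: CossartJannsenSaito2020, Thm. 3.10 (1) (proof, (3.7)–(3.8))] -/
theorem IsBlowup.hsPsi_le_of_residuallyIntegral [IsLocallyNoetherian X] (hπ : IsBlowup π J)
    (x' : X') (hUC : IsUniversallyCatenaryRing (X.presheaf.stalk (π.base x')))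
    (hint : ∀ y : X'.presheaf.stalk x', ∃ P : (X.presheaf.stalk (π.base x'))[X], P.Monic ∧
      (P.map (π.stalkMap x').hom).eval y ∈ maximalIdeal (X'.presheaf.stalk x')) :
    Scheme.hsPsi X (π.base x') ≤ Scheme.hsPsi X' x' :=
  (hπ.hsPsi_le_and_le_and_eq_of_residuallyIntegral x' hUC hint).1

/-- **`ψ_{X'}(x') ≤ dim 𝒪_{X,π x'}`** at a residually algebraic point of a blow-up, `𝒪_{X,π x'}`
universally catenary. [cite: CossartJannsenSaito2020, Thm. 3.10 (1) (proof, (3.8))] -/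
theorem IsBlowup.hsPsi_le_ringKrullDim_of_residuallyIntegral [IsLocallyNoetherian X]
    (hπ : IsBlowup π J) (x' : X') (hUC : IsUniversallyCatenaryRing (X.presheaf.stalk (π.base x')))
    (hint : ∀ y : X'.presheaf.stalk x', ∃ P : (X.presheaf.stalk (π.base x'))[X], P.Monic ∧
      (P.map (π.stalkMap x').hom).eval y ∈ maximalIdeal (X'.presheaf.stalk x')) :
    (Scheme.hsPsi X' x' : WithBot ℕ∞) ≤ ringKrullDim (X.presheaf.stalk (π.base x')) :=
  (hπ.hsPsi_le_and_le_and_eq_of_residuallyIntegral x' hUC hint).2.1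

/-- **CJS (3.13) with `δ = 0`: `ψ_{X'}(x') = ψ_X(π x')` when `𝒪_{X,π x'} → 𝒪_{X',x'}` is injective**
(Thm. 3.10 (3): then every component of `X` through `π x'` has its strict transform through `x'`;
Lemma 3.11), for `x'` residually algebraic over `π x'` and `𝒪_{X,π x'}` universally catenary.
[cite: CossartJannsenSaito2020, Thm. 3.10 (3) (proof, (3.13)), Lemma 3.11] -/
theorem IsBlowup.hsPsi_eq_of_residuallyIntegral_of_injective [IsLocallyNoetherian X]
    (hπ : IsBlowup π J) (x' : X') (hUC : IsUniversallyCatenaryRing (X.presheaf.stalk (π.base x')))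
    (hint : ∀ y : X'.presheaf.stalk x', ∃ P : (X.presheaf.stalk (π.base x'))[X], P.Monic ∧
      (P.map (π.stalkMap x').hom).eval y ∈ maximalIdeal (X'.presheaf.stalk x'))
    (hinjπ : Function.Injective (π.stalkMap x').hom) :
    Scheme.hsPsi X' x' = Scheme.hsPsi X (π.base x') :=
  (hπ.hsPsi_le_and_le_and_eq_of_residuallyIntegral x' hUC hint).2.2 hinjπ

/-! ## `H_{X'}(x') ≤ H_X(π x')` at residually finite points of the blow-up of a closed point -/

/-- **CJS Thm. 3.10 (1), `H_{X'}(x') ≤ H_X(π x')`, for the blow-up of a closed point of an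
ARBITRARY (possibly reducible, non-equidimensional) locally noetherian scheme, at the residually
finite points of the fibre.** Let `π : X' → X` be a blowing up along `J` with `J_x = 𝔪_x` at
`x = π x'`, `𝒪_{X,x}` universally catenary (e.g. `X` excellent), and `x'` residually finite over
`x` (`k(x')` generated over `k(x)` by finitely many integral elements — every closed point of the
fibre). Then `H^N_{X'}(x') ≤ H^N_X(x)` for every `N > ψ_{X'}(x')`: the Bennett–Hironaka inequality
`H^{(1)}(𝒪_{X',x'}) ≤ H^{(1)}(𝒪_{X,x})` shifted by `φ = N − ψ`, using `ψ_X(x) ≤ ψ_{X'}(x')`.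
[cite: CossartJannsenSaito2020, Thm. 3.10 (1) (p. 43), proof (3.7)–(3.9) (p. 44)] -/
theorem IsBlowup.hsFun_le_of_residuallyFinite_of_isUniversallyCatenaryRing [IsLocallyNoetherian X]
    [IsLocallyNoetherian X'] (hπ : IsBlowup π J) (x' : X')
    (hUC : IsUniversallyCatenaryRing (X.presheaf.stalk (π.base x')))
    (hJ : stalkIdeal J (π.base x') = maximalIdeal (X.presheaf.stalk (π.base x')))
    (T : Finset (X'.presheaf.stalk x'))
    (hTgen : ∀ y : X'.presheaf.stalk x', ∃ z ∈ Subring.closure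
      (Set.range (π.stalkMap x').hom ∪ (T : Set (X'.presheaf.stalk x'))),
      y - z ∈ maximalIdeal (X'.presheaf.stalk x'))
    (hTint : ∀ t ∈ T, ∃ P : (X.presheaf.stalk (π.base x'))[X], P.Monic ∧
      (P.map (π.stalkMap x').hom).eval t ∈ maximalIdeal (X'.presheaf.stalk x'))
    (N : ℕ) (hN : Scheme.hsPsi X' x' < N) :
    Scheme.hsFun X' N x' ≤ Scheme.hsFun X N (π.base x') := by
  have hint := exists_monic_map_eval_mem_of_residuallyFinite (π.stalkMap x').hom T hTgen hTint
  have hψ : Scheme.hsPsi X (π.base x') ≤ Scheme.hsPsi X' x' :=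
    hπ.hsPsi_le_of_residuallyIntegral x' hUC hint
  have h1 : hilbertSamuelFun (X'.presheaf.stalk x') 1 ≤
      hilbertSamuelFun (X.presheaf.stalk (π.base x')) 1 :=
    hπ.hilbertSamuelFun_stalk_le_of_residuallyFinite x' hJ T hTgen hTint 1 le_rfl
  rw [Scheme.hsFun_def, Scheme.hsFun_def]
  have hψdef : Scheme.hsPsi X' x' = minimalPrimesCodim (X'.presheaf.stalk x') := rfl
  exact hilbertSamuelFun_sub_le_of_le (a := 1) h1 hψ (by omega)

/-- The same at a point of the fibre with **finite residue field extension `k(x) → k(x')`** (every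
closed point of the fibre), for **`N > dim 𝒪_{X,x}`** (which bounds `ψ_{X'}(x')`,
`IsBlowup.hsPsi_le_ringKrullDim_of_residuallyIntegral`).
[cite: CossartJannsenSaito2020, Thm. 3.10 (1) (p. 43–44)] -/
theorem IsBlowup.hsFun_le_of_finite_residueFieldMap_of_isUniversallyCatenaryRing
    [IsLocallyNoetherian X] [IsLocallyNoetherian X'] (hπ : IsBlowup π J) (x' : X')
    (hUC : IsUniversallyCatenaryRing (X.presheaf.stalk (π.base x')))
    (hJ : stalkIdeal J (π.base x') = maximalIdeal (X.presheaf.stalk (π.base x')))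
    (hfin : (ResidueField.map (π.stalkMap x').hom).Finite)
    (N : ℕ) (hN : ringKrullDim (X.presheaf.stalk (π.base x')) < N) :
    Scheme.hsFun X' N x' ≤ Scheme.hsFun X N (π.base x') := by
  obtain ⟨T, hTgen, hTint⟩ := exists_residuallyFinite_of_finite_residueField (π.stalkMap x').hom hfin
  have hint := exists_monic_map_eval_mem_of_residuallyFinite (π.stalkMap x').hom T hTgen hTint
  have hψ := hπ.hsPsi_le_ringKrullDim_of_residuallyIntegral x' hUC hint
  have hψN : (Scheme.hsPsi X' x' : WithBot ℕ∞) < N := lt_of_le_of_lt hψ hN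
  exact hπ.hsFun_le_of_residuallyFinite_of_isUniversallyCatenaryRing x' hUC hJ T hTgen hTint N
    (by exact_mod_cast hψN)

/-! ## Assembly: `H^N_{X'}(x') ≤ H^N_X(π x')` at every point of the blow-up of a closed point -/

variable {x : X}

/-- **CJS Thm. 3.10 (1) for the blow-up of a closed point of an arbitrary locally noetherian
scheme, at every point of `X'` — abstract assembly** (the integrality-free form of
`IsBlowup.hsFun_le_of_isClosed_point_centre'`). Let `x ∈ X` be a closed point with `𝒪_{X,x}`
universally catenary, `π : X' → X` a blow-up of `x` (`IsBlowup π I({x})`), and `N > dim 𝒪_{X,x}`.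
Assume: (`hsp`) every point of the fibre specialises, without decrease of `H^N_{X'}`, to a closed
point; (`hfin`) the closed points of `X'` over `x` have residue field finite over `k(x)`. Then
`H^N_{X'}(x') ≤ H^N_X(π x')` for every `x' ∈ X'`.
[cite: CossartJannsenSaito2020, Thm. 3.10 (1) (p. 44)] -/
theorem IsBlowup.hsFun_le_of_point_centre' [IsLocallyNoetherian X] [IsLocallyNoetherian X']
    (hx : IsClosed ({x} : Set X))
    (hπ : IsBlowup π (Scheme.IdealSheafData.vanishingIdeal ⟨{x}, hx⟩))
    (hUC : IsUniversallyCatenaryRing (X.presheaf.stalk x)) (N : ℕ)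
    (hN : ringKrullDim (X.presheaf.stalk x) < N)
    (hsp : ∀ a : X', π.base a = x →
      ∃ b : X', IsClosed ({b} : Set X') ∧ a ⤳ b ∧ Scheme.hsFun X' N a ≤ Scheme.hsFun X' N b)
    (hfin : ∀ y' : X', IsClosed ({y'} : Set X') → π.base y' = x →
      (ResidueField.map (π.stalkMap y').hom).Finite)
    (x' : X') : Scheme.hsFun X' N x' ≤ Scheme.hsFun X N (π.base x') := by
  by_cases hx' : π.base x' = x
  · -- on the fibre: specialise to a closed point of the fibre
    obtain ⟨y', hy'cl, hxy', hle⟩ := hsp x' hx'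
    have hπy' : π.base y' = x := by
      have hsp' : π.base x' ⤳ π.base y' := hxy'.map π.base.hom.continuous
      rw [hx'] at hsp'
      have hmem : π.base y' ∈ closure ({x} : Set X) := hsp'.mem_closure
      rw [hx.closure_eq] at hmem
      exact hmem
    have hJ : stalkIdeal (Scheme.IdealSheafData.vanishingIdeal ⟨{x}, hx⟩) (π.base y') =
        maximalIdeal (X.presheaf.stalk (π.base y')) := by
      have hcl' : (⟨{x}, hx⟩ : TopologicalSpace.Closeds X) = ⟨closure {x}, isClosed_closure⟩ :=
        TopologicalSpace.Closeds.ext hx.closure_eq.symm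
      rw [hπy', hcl']
      exact stalkIdeal_vanishingIdeal_closure_self x
    have hUC' : IsUniversallyCatenaryRing (X.presheaf.stalk (π.base y')) := by rw [hπy']; exact hUC
    have hN' : ringKrullDim (X.presheaf.stalk (π.base y')) < N := by rw [hπy']; exact hN
    calc Scheme.hsFun X' N x' ≤ Scheme.hsFun X' N y' := hle
      _ ≤ Scheme.hsFun X N (π.base y') :=
          hπ.hsFun_le_of_finite_residueFieldMap_of_isUniversallyCatenaryRing y' hUC' hJ
            (hfin y' hy'cl hπy') N hN'
      _ = Scheme.hsFun X N (π.base x') := by rw [hπy', hx']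
  · exact (hπ.hsFun_eq_of_ne hx hx' N).le

/-- **CJS Thm. 3.10 (1) for the blow-up of a closed point of a quasi-excellent scheme, at every
point of `X'`** (no integrality). Let `X` be locally noetherian and quasi-excellent, `x ∈ X` a
closed point with `𝒪_{X,x}` universally catenary (e.g. `X` excellent), `π : X' → X` a blow-up of
`x`, and `N > dim 𝒪_{X,x}`. Then `H^N_{X'}(x') ≤ H^N_X(π x')` for every `x' ∈ X'`.
[cite: CossartJannsenSaito2020, Thm. 3.10 (1) (p. 44)] -/
theorem IsBlowup.hsFun_le_of_point_centre_of_isQuasiExcellent [IsLocallyNoetherian X]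
    (hqe : Scheme.IsQuasiExcellent X) (hx : IsClosed ({x} : Set X))
    (hπ : IsBlowup π (Scheme.IdealSheafData.vanishingIdeal ⟨{x}, hx⟩))
    (hUC : IsUniversallyCatenaryRing (X.presheaf.stalk x)) (N : ℕ)
    (hN : ringKrullDim (X.presheaf.stalk x) < N)
    (x' : X') : Scheme.hsFun X' N x' ≤ Scheme.hsFun X N (π.base x') := by
  haveI : IsProper π := hπ.isProper
  haveI : IsLocallyNoetherian X' := LocallyOfFiniteType.isLocallyNoetherian π
  -- the fibre over the closed point `x` is closed and Jacobson
  have hF : IsClosed (π.base ⁻¹' ({x} : Set X)) := hx.preimage π.base.hom.continuous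
  haveI : JacobsonSpace (π.base ⁻¹' ({x} : Set X)) :=
    .of_isClosedEmbedding (π.fiberHomeo x).symm.isClosedEmbedding
  refine hπ.hsFun_le_of_point_centre' hx hUC N hN (fun a ha => ?_)
    (fun y' hy' _ => finite_residueFieldMap_of_isClosed π hy') x'
  refine Scheme.exists_isClosed_specializes_hsFun_le N a hF ha
    (isOpen_regularLocus_subscheme_of_locallyOfFiniteType π hqe _) (fun b _ hab => ?_)
  have hπb : π.base b = x := by
    have hsp' : π.base a ⤳ π.base b := hab.map π.base.hom.continuous
    rw [show π.base a = x from ha] at hsp'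
    have hmem : π.base b ∈ closure ({x} : Set X) := hsp'.mem_closure
    rw [hx.closure_eq] at hmem
    exact hmem
  have hUCb : IsUniversallyCatenaryRing (X.presheaf.stalk (π.base b)) := by rw [hπb]; exact hUC
  exact isCatenaryRing_stalk_of_locallyOfFiniteType π b hUCb

/-- **CJS Thm. 3.10 (1) for the blow-up of a closed point of ANY scheme locally of finite type
over a field, at every point of `X'` — unconditionally** (reducible, non-reduced,
non-equidimensional `X` allowed). For `N > dim 𝒪_{X,x}` (e.g. `N > dim X`):
`H^N_{X'}(x') ≤ H^N_X(π x')` for every `x' ∈ X'` — the hypothesis `hmono` of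
`Scheme.no_infinite_hsFun_tower` for this blow-up. (`X` is excellent by Stacks 07QW.)
[cite: CossartJannsenSaito2020, Thm. 3.10 (1) (p. 44)] [cite: StacksProject, Tag 07QW] -/
theorem IsBlowup.hsFun_le_of_point_centre_of_locallyOfFiniteType {k : Type u} [Field k]
    (f : X ⟶ Spec (.of k)) [LocallyOfFiniteType f] (hx : IsClosed ({x} : Set X))
    (hπ : IsBlowup π (Scheme.IdealSheafData.vanishingIdeal ⟨{x}, hx⟩)) (N : ℕ)
    (hN : ringKrullDim (X.presheaf.stalk x) < N) (x' : X') :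
    Scheme.hsFun X' N x' ≤ Scheme.hsFun X N (π.base x') := by
  haveI : IsLocallyNoetherian X := LocallyOfFiniteType.isLocallyNoetherian f
  have hexc : Scheme.IsExcellent X := Scheme.isExcellent_of_locallyOfFiniteType Stacks07QW_field_holds f
  exact hπ.hsFun_le_of_point_centre_of_isQuasiExcellent hexc.isQuasiExcellent hx
    (hexc.isUniversallyCatenaryRing_stalk x) N hN x'

end Literature.AlgebraicGeometry.Resolution
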